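import Summits.ResolutionOfSingularities.ResolutionOfSingularities.Theorems.PurelyInseparableDim4ResCone
import Summits.ResolutionOfSingularities.ResolutionOfSingularities.Theorems.PurelyInseparableDim4PhiLineStepResidual
import Literature.AlgebraicGeometry.Resolution.RegularLocalRingsNormal
import HarnessLib

/-!
# (K-Φ2) chain dictionary XI: CONE BRIDGE — the cell's residual cone `resForm s` IS `in_d G`, so `e_G = 2` is IX/X's `hT`

Cell `res-dim4-pi` (D-0157 DOOR 2), Φ = β_h line (CARD I-1-8, residue (R1)). The Φ-line files ((K-Φ2) IX `exists_label_readaptation`, X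
`exists_label_readaptation_of_step`) phrase «the child is again a binary cone» as `2 ≤ finrank K (additiveSubspace (homogeneousComponent d G′))`
for a residual `G′` with `s′.F = x^{r′}·G′`, `ord₀ G′ = d`; the cell's chain vocabulary (`ResCone.resForm`, `ResCone.resVertex`, `e_G = finrank
(resVertex s)`) says `finrank K (resVertex s′) = 2`. This file (DEF-FREE) identifies the two: `resForm_eq_homogeneousComponent`,
`resVertex_eq_additiveSubspace`, `two_le_finrank_additiveSubspace_of_resVertex`.

[OURS · counted 0 · AI work weaker than expert review.] Nothing here proves K2(p), the β_h line, or resolution of singularities in dimension ≥ 4 /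
characteristic p.

Sources: V. Cossart, U. Jannsen, S. Saito (2020) Def. 1.26 / Lemma 12.2 (the directrix of the tangent cone) [`CossartJannsenSaito2020`].
-/

set_option linter.dupNamespace false

noncomputable section

namespace Summit.ResolutionOfSingularities.ResolutionOfSingularities.Theorems.PIDim4

namespace PhiLine

open MvPolynomial Finset
open Literature.AlgebraicGeometry.Resolution
open Literature.AlgebraicGeometry.Resolution.CentreBlowup
open Literature.AlgebraicGeometry.Resolution.Hauser2010
open Literature.AlgebraicGeometry.Resolution.HauserPerlega2019

variable {K : Type} [Field K]

/-- **`resForm s = in_d G`** for a presented state `s.F = x^{s.r}·G` with `ord₀ G = d`: the initial form of `s.F` is `x^{s.r}·in_d G`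
(`ord₀ s.F = |s.r| + d`), and dividing by the boundary monomial returns `in_d G`. [cite: CossartJannsenSaito2020, Def. 1.26] -/
theorem resForm_eq_homogeneousComponent {s : State K} {G : MvPolynomial (Fin 4) K} {d : ℕ} (hF : s.F = monomial s.r 1 * G)
    (hd : ordZero G = d) : ResCone.resForm s = homogeneousComponent d G := by
  classical
  have hord : (ordZero s.F).toNat = s.r.degree + d := by
    rw [hF, ordZero_monomial_one_mul, hd, ← Nat.cast_add, ENat.toNat_coe]
  unfold ResCone.resForm initialForm
  rw [hord, hF, homogeneousComponent_mul_of_isHomogeneous_left (isHomogeneous_monomial (1 : K) rfl) d, divMonomial_monomial_mul]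

/-- Hence **`resVertex s = A(in_d G)`**. [cite: CossartJannsenSaito2020, Def. 1.26] -/
theorem resVertex_eq_additiveSubspace {s : State K} {G : MvPolynomial (Fin 4) K} {d : ℕ} (hF : s.F = monomial s.r 1 * G)
    (hd : ordZero G = d) : ResCone.resVertex s = PointBlowup.additiveSubspace (homogeneousComponent d G) := by
  unfold ResCone.resVertex
  rw [resForm_eq_homogeneousComponent hF hd]

/-- **`e_G = 2` ⇒ IX/X's `hT`**: `finrank (resVertex s) = 2` gives `2 ≤ finrank K A(in_d G)`. [cite: CossartJannsenSaito2020, Def. 1.26] -/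
theorem two_le_finrank_additiveSubspace_of_resVertex {s : State K} {G : MvPolynomial (Fin 4) K} {d : ℕ} (hF : s.F = monomial s.r 1 * G)
    (hd : ordZero G = d) (he : Module.finrank K (ResCone.resVertex s) = 2) :
    2 ≤ Module.finrank K (PointBlowup.additiveSubspace (homogeneousComponent d G)) := by
  rw [← resVertex_eq_additiveSubspace hF hd, he]

end PhiLine

end Summit.ResolutionOfSingularities.ResolutionOfSingularities.Theorems.PIDim4

end
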